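import Literature.Geometry.Kaehler.ComplexTorusEquivariantEndomorphismAlgebraCommutantCenterRosati
import Literature.Geometry.Kaehler.ComplexTorusHodgeLieAlgebraRatReductive
import HarnessLib

/-!
# The Hodge group of an equality-case `G`-torus lies in the unitary torus of the CM algebra `Z(End_ℚ^G(X))`:
# `2 · dim Hg(X) ≤ #{χ occurring} = dim_ℚ Z(End_ℚ^G(X))` (Lange 2023 Prop. 7.2.5–7.2.6, Ex. 7.2.4 (4);
# Moonen–Zarhin 1999 §1; Dolgachev–Zarhin Remark 2.17)

Layer `Literature/Geometry/Kaehler`, namespace `Literature.Geometry.Kaehler.ComplexTorus`; lane `lit-hodgefound` (Track 2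
foundations library), Layer A2, row «A2-26(ee)» (self-proposed 2026-08-27, prover seat `lit-hodgefound-p10`, generation 25,
FILE 8; sequel to g25-#7 `…CommutantCenterRosati` (`V = ρ̄(Z(ℚ[G])) = V⁺ ⊕ V⁻`, `2·dim V⁻ = dim V = #{χ occurring}`
in the equality case), g25-#5 `…CommutantCenterDimension`, g24's `…CommutantHodgeGroupClassSums` (the group-level
`Hg(X)(ℝ) ⊆ span_ℝ{A_g}`) and the tree's rational Hodge Lie algebra `𝒜 = hodgeGroupLieRat Φ`
(`ComplexTorusHodgeLieAlgebraRatForm`, `…RatReductive`: `dim_ℚ 𝒜 = dim_ℝ 𝔥𝔤_ℝ = dim Hg(X)`)).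
Everything here is **proved**; no definition, no named fact.

## The mathematics

Let `X = E/Φ(ℤ^ι)` carry the action `ρ` of a finite group `G`, with `End_ℚ^G(X) = C(ρ) = End_{ℚ[G]}(H₁(X,ℚ))`
(Dolgachev–Zarhin's equality case).  The Lie algebra `𝒜 ⊆ 𝔤𝔩(H₁(X,ℚ))` of the Hodge group commutes with
`End_ℚ(X) ∋ ρ(g)` (Lange Prop. 7.2.5), so `𝒜 ⊆ C(ρ) = End_ℚ^G(X)`, and commuting with all of `End_ℚ^G(X)` it lies in
the CENTRE: `𝒜 ⊆ Z(End_ℚ^G(X)) = V = ρ̄(Z(ℚ[G]))` (§1–§2).  The Hodge group preserves every polarization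
(`𝒜 ⊆ 𝔰𝔭(E)`, Moonen–Zarhin §1 / Lange Ex. 7.2.4 (4)); for gen 24's `G`-invariant Shimura polarization
`E = N·S·ρ̄(x)` (`S = Σ_g ρ(g)ᵀρ(g)`, `x ∈ Z(ℚ[G])` odd, `ρ̄(x)` invertible and commuting with `𝒜 ⊆ V`) the condition
`AᵀE = -EA` becomes `AᵀS = -SA`: **`𝒜 ⊆ V⁻`**, the `-1`-eigenspace of the Rosati involution on the CM algebra
`Z = Z(End_ℚ^G(X))` — the Lie algebra of the unitary torus `U_Z = {z ∈ Z : z z' = 1}` (§2).  Hence (§3)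
**`2 · dim Hg(X) = 2 · dim_ℚ 𝒜 ≤ 2 · dim_ℚ V⁻ = dim_ℚ V = #{χ ∈ Irr(G) occurring in H₁(X,ℂ)} = dim_ℚ Z(End_ℚ^G(X))`**
(g25-#7, g25-#5) — the `G`-torus form of "`Hg(A) ⊆ U_K`, `dim Hg(A) ≤ ½[K : ℚ]`" for abelian varieties with complex
multiplication; and `𝒜` is abelian (`X` is of CM type, Lange Prop. 7.2.6, recovered).

## Sources, verbatim

H. Lange (2023), §7.2.2 Prop. 7.2.5: "`End_ℚ(X) ≃ End(V)^{Hg(X)}`"; §7.2.3 Prop. 7.2.6: "`X` admits complex multiplication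
if and only if `Hg(X)` is commutative (a torus)"; §7.2.4 Exercise (4): "`Hg(X) ⊆ Lf(X) ⊆ Sp(W, E)`".  B. Moonen,
Yu. Zarhin (1999), §1: "`Hg(X) ⊂ Sp_D(V, φ)`".  M. Green, P. Griffiths, M. Kerr (2012), §II.C (the `ℚ`-Lie algebra `𝒜`).
I. Dolgachev, Yu. G. Zarhin (2024), §2.2 Remark 2.17, (2.18).  G. Shimura (1998), §6.2 Thm. 4 (the element `ζ`,
`ζ^ρ = -ζ`, of the polarization `E(ρ_{K/ℚ}(ζ x y^ρ))`).

## What is proved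

* §1 (any `G`-torus) `mem_centralizer_of_mem_hodgeGroupLieRat` (`𝒜 ⊆ C(ρ)`), `coe_hodgeGroupLieRat_subset_centralizer`.
* §2 (equality case) `mem_endAlgRatG_of_mem_hodgeGroupLieRat`, **`mem_map_center_of_mem_hodgeGroupLieRat`** (`𝒜 ⊆ V`),
  `hodgeGroupLieRat_comm` / `isLieAbelian_hodgeGroupLieRat` / `isLieAbelian_hodgeGroupLie` (`𝒜`, `𝔥𝔤_ℝ` abelian),
  **`mem_skewAdjoint_invGram_of_mem_hodgeGroupLieRat`** (`𝒜 ⊆ V⁻`), `rosati_invGram_eq_neg_of_mem_hodgeGroupLieRat`,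
  `coe_hodgeGroupLieRat_subset_map_center_inf_skew`.
* §3 (equality case) `finrank_hodgeGroupLieRat_le_finrank_map_center_inf_skew`, **`two_mul_finrank_hodgeGroupLieRat_le_card`**,
  **`two_mul_finrank_hodgeGroupLie_le_card`** (`2 · dim_ℝ 𝔥𝔤_ℝ ≤ #{χ occurring}`),
  **`two_mul_finrank_hodgeGroupLie_le_finrank_center`** (`2 · dim Hg(X) ≤ dim_ℚ Z(End_ℚ^G(X))`),
  `two_mul_finrank_hodgeGroupLieRat_le_finrank_center`, `two_mul_finrank_hodgeGroupLie_le_card_irrChars` (`≤ |Irr(G)|`).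

## References

* [Lange2023AbelianVarietiesComplex] H. Lange, *Abelian Varieties over the Complex Numbers*, Springer (2023), §7.2.2
  Prop. 7.2.5, §7.2.3 Prop. 7.2.6, §7.2.4 Exercise (4).
* [MoonenZarhin1999LowDim] B. Moonen, Yu. G. Zarhin, *Hodge classes on abelian varieties of low dimension*, Math. Ann.
  315 (1999), §1.
* [GreenGriffithsKerr2012] M. Green, P. Griffiths, M. Kerr, *Mumford–Tate Groups and Domains*, Princeton (2012), §II.C.
* [DolgachevZarhin2024] I. Dolgachev, Yu. G. Zarhin, *Endomorphisms of Complex Abelian Varieties* (2024), §2.2 Remark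
  2.17, (2.18).
* [Shimura1998] G. Shimura, *Abelian Varieties with Complex Multiplication and Modular Functions*, Princeton (1998),
  §6.2 Thm. 4.
-/

noncomputable section

open Module Function
open scoped Matrix

namespace Literature.Geometry.Kaehler

namespace ComplexTorus

open HopfAlgebra Literature.RepresentationTheory.FiniteGroups

universe u

/-! ### §1 `𝒜 ⊆ C(ρ)` -/

section Centralizer

variable {ι : Type u} [Fintype ι] [DecidableEq ι] {E : Type*} [NormedAddCommGroup E] [NormedSpace ℂ E]
  {Φ : (ι → ℝ) ≃L[ℝ] E} {G : Type} [Group G] (ρ : G →* endAlgRat Φ)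

/-- **`𝒜 ⊆ C(ρ)`**: the rational Hodge Lie algebra commutes with `End_ℚ(X)`, in particular with every `ρ(g)`.
[cite: Lange2023AbelianVarietiesComplex, §7.2.2 Prop. 7.2.5 ("`End_ℚ(X) ≃ End(V)^{Hg(X)}`")] -/
theorem mem_centralizer_of_mem_hodgeGroupLieRat {A : Matrix ι ι ℚ} (hA : A ∈ hodgeGroupLieRat Φ) :
    A ∈ Subalgebra.centralizer ℚ (Set.range fun g : G ↦ ((ρ g : endAlgRat Φ) : Matrix ι ι ℚ)) :=
  (mem_centralizer_range_iff ρ).2 fun g ↦ (mul_comm_of_mem_hodgeGroupLieRat_of_mem_endAlgRat hA (ρ g).2).symm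

/-- `𝒜 ⊆ C(ρ)` (set form). [cite: Lange2023AbelianVarietiesComplex, §7.2.2 Prop. 7.2.5] -/
theorem coe_hodgeGroupLieRat_subset_centralizer :
    (hodgeGroupLieRat Φ : Set (Matrix ι ι ℚ)) ⊆
      Subalgebra.centralizer ℚ (Set.range fun g : G ↦ ((ρ g : endAlgRat Φ) : Matrix ι ι ℚ)) :=
  fun _ hA ↦ mem_centralizer_of_mem_hodgeGroupLieRat ρ hA

end Centralizer

/-! ### §2 The equality case: `𝒜 ⊆ V⁻ ⊆ V = Z(End_ℚ^G(X))` -/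

section EqualityCase

variable {ι : Type u} [Fintype ι] [DecidableEq ι] {E : Type*} [NormedAddCommGroup E] [NormedSpace ℂ E]
  {Φ : (ι → ℝ) ≃L[ℝ] E} {G : Type} [Group G] [Fintype G] (ρ : G →* endAlgRat Φ)

omit [Fintype G] in
/-- `𝒜 ⊆ End_ℚ^G(X)` in the equality case (`𝒜 ⊆ C(ρ) = End_ℚ^G(X)`). [cite: DolgachevZarhin2024, §2.2 Remark 2.17, p0035]
[cite: Lange2023AbelianVarietiesComplex, §7.2.2 Prop. 7.2.5] -/
theorem mem_endAlgRatG_of_mem_hodgeGroupLieRat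
    (h : endAlgRatG Φ ρ = Subalgebra.centralizer ℚ (Set.range fun g : G ↦ ((ρ g : endAlgRat Φ) : Matrix ι ι ℚ)))
    {A : Matrix ι ι ℚ} (hA : A ∈ hodgeGroupLieRat Φ) : A ∈ endAlgRatG Φ ρ := by
  rw [h]
  exact mem_centralizer_of_mem_hodgeGroupLieRat ρ hA

/-- **`𝒜 ⊆ V = ρ̄(Z(ℚ[G])) = Z(End_ℚ^G(X))`** in the equality case: `𝒜 ⊆ End_ℚ^G(X) ⊆ End_ℚ(X)` commutes with all of
`End_ℚ^G(X)`, so lies in its centre, which is `ρ̄(Z(ℚ[G]))` (gen 24 / g25-#5). [cite: Lange2023AbelianVarietiesComplex, §7.2.2 Prop. 7.2.5 and §7.2.3 Prop. 7.2.6]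
[cite: DolgachevZarhin2024, §2.2 Remark 2.17 and (2.18), p0035] -/
theorem mem_map_center_of_mem_hodgeGroupLieRat
    (h : endAlgRatG Φ ρ = Subalgebra.centralizer ℚ (Set.range fun g : G ↦ ((ρ g : endAlgRat Φ) : Matrix ι ι ℚ)))
    {A : Matrix ι ι ℚ} (hA : A ∈ hodgeGroupLieRat Φ) :
    A ∈ (Subalgebra.toSubmodule (Subalgebra.center ℚ (MonoidAlgebra ℚ G))).map
        ((endAlgRat Φ).val.toLinearMap ∘ₗ (groupAlgebraRep ρ).toLinearMap) := by
  have hAG : A ∈ endAlgRatG Φ ρ := mem_endAlgRatG_of_mem_hodgeGroupLieRat ρ h hA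
  have hcen : (⟨A, hAG⟩ : endAlgRatG Φ ρ) ∈ Subalgebra.center ℚ (endAlgRatG Φ ρ) := by
    rw [Subalgebra.mem_center_iff]
    intro c
    exact Subtype.ext (mul_comm_of_mem_hodgeGroupLieRat_of_mem_endAlgRat hA (endAlgRatG_le Φ ρ c.2)).symm
  obtain ⟨z, hz, hzA⟩ := exists_mem_center_groupAlgebraRep_eq_of_mem_center_endAlgRatG ρ h hcen
  exact (mem_map_center_iff ρ).2 ⟨z, hz, hzA⟩

/-- **`𝒜` is commutative in the equality case** (`𝒜 ⊆ V`, a commutative algebra): `X` is of CM type (Lange Prop. 7.2.6,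
gen 24's `hodgeGroup_comm`, at the Lie algebra level). [cite: Lange2023AbelianVarietiesComplex, §7.2.3 Prop. 7.2.6]
[cite: DolgachevZarhin2024, §2.2 Remark 2.17, p0035] -/
theorem hodgeGroupLieRat_comm
    (h : endAlgRatG Φ ρ = Subalgebra.centralizer ℚ (Set.range fun g : G ↦ ((ρ g : endAlgRat Φ) : Matrix ι ι ℚ)))
    {A B : Matrix ι ι ℚ} (hA : A ∈ hodgeGroupLieRat Φ) (hB : B ∈ hodgeGroupLieRat Φ) : A * B = B * A :=
  mul_comm_of_mem_map_center ρ (mem_map_center_of_mem_hodgeGroupLieRat ρ h hA)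
    (mem_map_center_of_mem_hodgeGroupLieRat ρ h hB)

/-- `𝒜` is an abelian Lie algebra in the equality case. [cite: Lange2023AbelianVarietiesComplex, §7.2.3 Prop. 7.2.6] -/
theorem isLieAbelian_hodgeGroupLieRat
    (h : endAlgRatG Φ ρ = Subalgebra.centralizer ℚ (Set.range fun g : G ↦ ((ρ g : endAlgRat Φ) : Matrix ι ι ℚ))) :
    IsLieAbelian (hodgeGroupLieRat Φ) := by
  constructor
  intro A B
  apply Subtype.ext
  change A.1 * B.1 - B.1 * A.1 = 0
  rw [hodgeGroupLieRat_comm ρ h A.2 B.2, sub_self]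

/-- `𝔥𝔤_ℝ` is an abelian Lie algebra in the equality case. [cite: Lange2023AbelianVarietiesComplex, §7.2.3 Prop. 7.2.6] -/
theorem isLieAbelian_hodgeGroupLie
    (h : endAlgRatG Φ ρ = Subalgebra.centralizer ℚ (Set.range fun g : G ↦ ((ρ g : endAlgRat Φ) : Matrix ι ι ℚ))) :
    IsLieAbelian (hodgeGroupLie Φ) :=
  (isLieAbelian_hodgeGroupLieRat_iff Φ).1 (isLieAbelian_hodgeGroupLieRat ρ h)

/-- **`𝒜 ⊆ V⁻`: every `A ∈ 𝒜` is skew for the adjoint involution, `AᵀS = -SA`** (equality case).  `𝒜 ⊆ 𝔰𝔭(E)` for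
the `G`-invariant Shimura polarization with rational Gram matrix `E = N·S·ρ̄(x)`; `ρ̄(x) ∈ V` commutes with `A ∈ V`
and is invertible, so `AᵀS ρ̄(x) = -S A ρ̄(x)` gives `AᵀS = -SA`. [cite: MoonenZarhin1999LowDim, §1 ("`Hg(X) ⊂ Sp_D(V, φ)`")]
[cite: Lange2023AbelianVarietiesComplex, §7.2.4 Exercise (4)] [cite: Shimura1998, §6.2 Thm. 4, p0057] -/
theorem mem_skewAdjoint_invGram_of_mem_hodgeGroupLieRat
    (h : endAlgRatG Φ ρ = Subalgebra.centralizer ℚ (Set.range fun g : G ↦ ((ρ g : endAlgRat Φ) : Matrix ι ι ℚ)))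
    {A : Matrix ι ι ℚ} (hA : A ∈ hodgeGroupLieRat Φ) : A ∈ skewAdjointMatricesSubmodule (invGram ρ) := by
  obtain ⟨a, N, η, hac, hao, hN, hη, -, hE⟩ :=
    exists_isRiemannForm_isInvariantForm_skewGram_of_endAlgRatG_eq_centralizer ρ h
  set x : MonoidAlgebra ℚ G := ∑ g : G, a g • MonoidAlgebra.of ℚ G g with hx_def
  set u : Matrix ι ι ℚ := ((groupAlgebraRep ρ x : endAlgRat Φ) : Matrix ι ι ℚ) with hu_def
  have huV : u ∈ (Subalgebra.toSubmodule (Subalgebra.center ℚ (MonoidAlgebra ℚ G))).map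
      ((endAlgRat Φ).val.toLinearMap ∘ₗ (groupAlgebraRep ρ).toLinearMap) :=
    (mem_map_center_iff ρ).2 ⟨x, sum_smul_of_mem_center fun g k ↦ hac g k, rfl⟩
  -- `det u ≠ 0`
  have hdet : IsUnit (((N : ℚ) • skewGram ρ x).det) := isUnit_det_of_map_ratCast hE.symm hη.isUnit_det_latticeGram
  have hdetu : IsUnit u.det := by
    rw [Matrix.det_smul, skewGram, Matrix.det_mul] at hdet
    exact isUnit_of_mul_isUnit_right (isUnit_of_mul_isUnit_right hdet)
  -- `𝒜 ⊆ 𝔰𝔭(E)`: `Aᵀ (N S u) = -(N S u) A`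
  have hsp := hη.transpose_mul_eq_neg_mul_of_mem_hodgeGroupLieRat hE.symm hA
  have hN0 : (N : ℚ) ≠ 0 := Nat.cast_ne_zero.2 hN.ne'
  have hcomm : A * u = u * A :=
    mul_comm_of_mem_map_center ρ (mem_map_center_of_mem_hodgeGroupLieRat ρ h hA) huV
  have h1 : (Aᵀ * invGram ρ + invGram ρ * A) * u = 0 := by
    rw [skewGram, Matrix.mul_smul, Matrix.smul_mul, ← hu_def] at hsp
    have h2 : (N : ℚ) • (Aᵀ * (invGram ρ * u) + invGram ρ * u * A) = 0 := by
      rw [smul_add, hsp, neg_add_cancel]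
    have h3 : Aᵀ * (invGram ρ * u) + invGram ρ * u * A = 0 := (smul_eq_zero.1 h2).resolve_left hN0
    rw [Matrix.add_mul, Matrix.mul_assoc, Matrix.mul_assoc, hcomm, ← Matrix.mul_assoc (invGram ρ)]
    exact h3
  have h4 : Aᵀ * invGram ρ + invGram ρ * A = 0 := by
    have h5 := congrArg (fun M ↦ M * u⁻¹) h1
    simpa only [Matrix.mul_assoc, Matrix.mul_nonsing_inv _ hdetu, Matrix.mul_one, Matrix.zero_mul] using h5
  rw [mem_skewAdjointMatricesSubmodule]
  show Aᵀ * invGram ρ = invGram ρ * (-A)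
  rw [Matrix.mul_neg]
  exact eq_neg_of_add_eq_zero_left h4

/-- `A' = -A` for `A ∈ 𝒜` (equality case), `A' = S⁻¹AᵀS`. [cite: MoonenZarhin1999LowDim, §1] [cite: Lange2023AbelianVarietiesComplex, §7.2.4 Exercise (4)] -/
theorem rosati_invGram_eq_neg_of_mem_hodgeGroupLieRat
    (h : endAlgRatG Φ ρ = Subalgebra.centralizer ℚ (Set.range fun g : G ↦ ((ρ g : endAlgRat Φ) : Matrix ι ι ℚ)))
    {A : Matrix ι ι ℚ} (hA : A ∈ hodgeGroupLieRat Φ) : rosati (invGram ρ) A = -A :=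
  (mem_skewAdjoint_invGram_iff_rosati_eq_neg ρ A).1 (mem_skewAdjoint_invGram_of_mem_hodgeGroupLieRat ρ h hA)

/-- **`𝒜 ≤ V⁻ = V ∩ {AᵀS = -SA}`** (equality case): the Hodge Lie algebra lies in the Lie algebra of the unitary torus
of the CM algebra `Z(End_ℚ^G(X))`. [cite: Lange2023AbelianVarietiesComplex, §7.2.3 Prop. 7.2.6 and §7.2.4 Exercise (4)]
[cite: MoonenZarhin1999LowDim, §1] [cite: DolgachevZarhin2024, §2.2 Remark 2.17, p0035] -/
theorem coe_hodgeGroupLieRat_subset_map_center_inf_skew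
    (h : endAlgRatG Φ ρ = Subalgebra.centralizer ℚ (Set.range fun g : G ↦ ((ρ g : endAlgRat Φ) : Matrix ι ι ℚ))) :
    (hodgeGroupLieRat Φ : Set (Matrix ι ι ℚ)) ⊆
      ↑((Subalgebra.toSubmodule (Subalgebra.center ℚ (MonoidAlgebra ℚ G))).map
          ((endAlgRat Φ).val.toLinearMap ∘ₗ (groupAlgebraRep ρ).toLinearMap) ⊓
        skewAdjointMatricesSubmodule (invGram ρ)) :=
  fun _ hA ↦ ⟨mem_map_center_of_mem_hodgeGroupLieRat ρ h hA, mem_skewAdjoint_invGram_of_mem_hodgeGroupLieRat ρ h hA⟩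

end EqualityCase

/-! ### §3 `2 · dim Hg(X) ≤ #{χ occurring} = dim_ℚ Z(End_ℚ^G(X))` -/

section Dimension

variable {ι : Type u} [Fintype ι] [DecidableEq ι] {E : Type*} [NormedAddCommGroup E] [NormedSpace ℂ E]
  {Φ : (ι → ℝ) ≃L[ℝ] E} {G : Type} [Group G] [Fintype G] (ρ : G →* endAlgRat Φ)

/-- `dim_ℚ 𝒜 ≤ dim_ℚ V⁻` (equality case). [cite: Lange2023AbelianVarietiesComplex, §7.2.3 Prop. 7.2.6 and §7.2.4 Exercise (4)(b)] -/
theorem finrank_hodgeGroupLieRat_le_finrank_map_center_inf_skew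
    (h : endAlgRatG Φ ρ = Subalgebra.centralizer ℚ (Set.range fun g : G ↦ ((ρ g : endAlgRat Φ) : Matrix ι ι ℚ))) :
    finrank ℚ (hodgeGroupLieRat Φ) ≤
      finrank ℚ ↥((Subalgebra.toSubmodule (Subalgebra.center ℚ (MonoidAlgebra ℚ G))).map
            ((endAlgRat Φ).val.toLinearMap ∘ₗ (groupAlgebraRep ρ).toLinearMap) ⊓
          skewAdjointMatricesSubmodule (invGram ρ)) := by
  letI : LieRing (Matrix ι ι ℚ) := LieRing.ofAssociativeRing
  change finrank ℚ (hodgeGroupLieRat Φ).toSubmodule ≤ _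
  exact Submodule.finrank_mono fun A hA ↦ coe_hodgeGroupLieRat_subset_map_center_inf_skew ρ h hA

/-- **`2 · dim_ℚ 𝒜 ≤ #{χ ∈ Irr(G) occurring in H₁(X,ℂ)}`** (equality case; g25-#7: `2 · dim V⁻ = #{χ occurring}`).
[cite: DolgachevZarhin2024, §2.2 Remark 2.17 and (2.18), p0035] [cite: Lange2023AbelianVarietiesComplex, §7.2.3 Prop. 7.2.6] -/
theorem two_mul_finrank_hodgeGroupLieRat_le_card
    (h : endAlgRatG Φ ρ = Subalgebra.centralizer ℚ (Set.range fun g : G ↦ ((ρ g : endAlgRat Φ) : Matrix ι ι ℚ))) :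
    2 * finrank ℚ (hodgeGroupLieRat Φ) ≤
      ((irrChars_finite_holds G).toFinset.filter fun χ ↦ complexGroupAlgebraRep ρ (charIdempotent χ) ≠ 0).card := by
  rw [← finrank_map_center_groupAlgebraRep_eq_card ρ, ← two_mul_finrank_map_center_inf_skew ρ h]
  exact Nat.mul_le_mul_left 2 (finrank_hodgeGroupLieRat_le_finrank_map_center_inf_skew ρ h)

/-- **THE DIMENSION OF THE HODGE GROUP OF AN EQUALITY-CASE `G`-TORUS: `2 · dim Hg(X) ≤ #{χ occurring}`**, with
`dim Hg(X) = dim_ℝ 𝔥𝔤_ℝ = dim_ℚ 𝒜` (`𝔥𝔤_ℝ = 𝒜 ⊗ ℝ`). [cite: Lange2023AbelianVarietiesComplex, §7.2.3 Prop. 7.2.6 and §7.3.1 (proof of Prop. 7.3.2)]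
[cite: DolgachevZarhin2024, §2.2 Remark 2.17 and (2.18), p0035] [cite: GreenGriffithsKerr2012, §II.C] -/
theorem two_mul_finrank_hodgeGroupLie_le_card
    (h : endAlgRatG Φ ρ = Subalgebra.centralizer ℚ (Set.range fun g : G ↦ ((ρ g : endAlgRat Φ) : Matrix ι ι ℚ))) :
    2 * finrank ℝ (hodgeGroupLie Φ) ≤
      ((irrChars_finite_holds G).toFinset.filter fun χ ↦ complexGroupAlgebraRep ρ (charIdempotent χ) ≠ 0).card := by
  rw [← finrank_hodgeGroupLieRat_eq]
  exact two_mul_finrank_hodgeGroupLieRat_le_card ρ h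

/-- **`2 · dim Hg(X) ≤ dim_ℚ Z(End_ℚ^G(X))`**: the Hodge group of an equality-case `G`-torus is a subtorus of the
unitary torus `U_Z` (`dim U_Z = ½ dim_ℚ Z`) of the CM algebra `Z = Z(End_ℚ^G(X))` — the `G`-form of
"`Hg(A) ⊆ U_K`, `dim Hg(A) ≤ ½[K : ℚ]`" for abelian varieties with complex multiplication.
[cite: Lange2023AbelianVarietiesComplex, §7.2.3 Prop. 7.2.6] [cite: DolgachevZarhin2024, §2.2 Remark 2.17 and (2.18), p0035]
[cite: Shimura1998, §6.2 Thm. 4, p0057] -/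
theorem two_mul_finrank_hodgeGroupLie_le_finrank_center
    (h : endAlgRatG Φ ρ = Subalgebra.centralizer ℚ (Set.range fun g : G ↦ ((ρ g : endAlgRat Φ) : Matrix ι ι ℚ))) :
    2 * finrank ℝ (hodgeGroupLie Φ) ≤ finrank ℚ (Subalgebra.center ℚ (endAlgRatG Φ ρ)) := by
  rw [finrank_center_endAlgRatG_eq_card ρ h]
  exact two_mul_finrank_hodgeGroupLie_le_card ρ h

/-- `2 · dim_ℚ 𝒜 ≤ dim_ℚ Z(End_ℚ^G(X))` (rational form). [cite: Lange2023AbelianVarietiesComplex, §7.2.3 Prop. 7.2.6]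
[cite: DolgachevZarhin2024, §2.2 Remark 2.17, p0035] -/
theorem two_mul_finrank_hodgeGroupLieRat_le_finrank_center
    (h : endAlgRatG Φ ρ = Subalgebra.centralizer ℚ (Set.range fun g : G ↦ ((ρ g : endAlgRat Φ) : Matrix ι ι ℚ))) :
    2 * finrank ℚ (hodgeGroupLieRat Φ) ≤ finrank ℚ (Subalgebra.center ℚ (endAlgRatG Φ ρ)) := by
  rw [finrank_hodgeGroupLieRat_eq]
  exact two_mul_finrank_hodgeGroupLie_le_finrank_center ρ h

/-- `2 · dim Hg(X) ≤ |Irr(G)|` (coarse form). [cite: DolgachevZarhin2024, §2.2 Remark 2.17, p0035] -/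
theorem two_mul_finrank_hodgeGroupLie_le_card_irrChars
    (h : endAlgRatG Φ ρ = Subalgebra.centralizer ℚ (Set.range fun g : G ↦ ((ρ g : endAlgRat Φ) : Matrix ι ι ℚ))) :
    2 * finrank ℝ (hodgeGroupLie Φ) ≤ (irrChars_finite_holds G).toFinset.card :=
  (two_mul_finrank_hodgeGroupLie_le_card ρ h).trans (Finset.card_filter_le _ _)

end Dimension

end ComplexTorus

end Literature.Geometry.Kaehler

end
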